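import Literature.MathematicalPhysics.QuantumFieldTheory.Balaban1983to89.T4ScaleMatchingRate

/-!
# `Balaban1983to89.T4BareLambdaRate` — NE4 (node U2): THE LATTICE-TO-CONTINUUM MATCHING RATE AT EVERY ULTRAVIOLET
# INDEX (ALSO BELOW `k₀`), AND THE BARE TWO-LOOP LAW WITH ITS CONSTANT AND A RATE —
# `1/g_K(0)² = K·β⁰_∞ + (β¹¹_∞/β⁰_∞)·log K + Λ₀ + O(log K/√K)` — under the named binders of `T4LambdaMatching`

Cell `pub-balaban`, T⁴ programme (T4-DAG node U2, spine estimate NE4 = the η-rate of the FULL β-functions, booked as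
β¹-half + β⁰-half; unit `b2b-balaban-t4-ne4-p2`, technique P2 "two-trajectory comparison at spacings ε vs ε/L: match
couplings scale by scale using the β-pert cell's (AF-0r) rate as input hypothesis and bound the β¹ mismatch",
generation 11, seventh node; journal row T4-U2.NE4-PROVE-P2k*).  Companion record
`run/shared/lean/pub/pub-balaban/t4/T4-EST-NE4-P2.md` v1.20 §26.  Sequel of `T4ScaleMatchingRate` (gen 10: the
matching `1/g_{j+m}(j)² − a⋆_m = δ_j + O(log m/√m)` with ONE constant, for ultraviolet indices `j ≥ k₀`) and of
`T4LambdaMatching` (gen 9: the bare two-loop law acquires its constant `Λ₀` as a PURE LIMIT), which it completes in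
the two directions gen 10's header left open ("below `k₀` only the limits of §4 are proved"; "not the Λ-parameters of
gen 9 (which need (TL))"): the rate now holds at EVERY ultraviolet index with one constant, and the Λ₀-law is
QUANTIFIED.

NEW module of unit `b2b-balaban-t4-ne4-p2` generation 11; imports `T4ScaleMatchingRate` (this lineage, gen 10, v1.1)
only and modifies nothing; every object of another lineage (`B12Beta.OneLoopSplit`, `FlowStep.*`,
`T4CouplingMatching.*`, `T4CauchySum.InjectedRate`, `T4BareCouplingChart.bareOf`, `T4ContinuumTwoLoopLaw.pinnedRun`)
and of this lineage's earlier nodes (`T4ContinuumCoupling.*`, `T4OneLoopAsymptotics.*`, `T4ContinuumLambda.*`,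
`T4LambdaMatching.*`, `T4ScaleMatchingRate.*`) is used BY NAME.

WHAT IS PROVED (kernel; every β-side input a NAMED BINDER, see BINDERS).  Setting as in `T4ScaleMatchingRate`: a
family `g : ℕ → ℕ → ℝ` of solutions of the recursion (0.20) `1/g_K(k+1)² = 1/g_K(k)² − β_{k+1}(g_K(0),…,g_K(k))` in
the box ]0,γ], run `K` of length `K`, all PINNED at the infrared end `g_K(K) = g_IR`, with node U2's output shape
`InjectedRate C 0 θ (disc (g K) (g (K+1)))`, `θ < 1`; `a⋆_m = lim_n 1/g_{n+m}(n)²` the continuum inverse running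
coupling (`T4ContinuumCoupling`), `b⋆_m = a⋆_{m+1} − a⋆_m`; `invSq g m j = 1/g_{j+m}(j)²`; `W_K(i)` the scale defect
(`T4ScaleMatchingRate.scaleDefect`); `δ_j = Σ_i (β⁰_{j+i} − β⁰_∞)` (`uvDefect`), `δ₀ = oneLoopDefect`;
`Λ⋆ = T4ContinuumLambda.contLambda`, `Λ₀ = T4LambdaMatching.bareLambda = Λ⋆ + δ₀`.
* §1 (elementary) `inv_sqrt_le_log_div_sqrt` (`1/√m ≤ (log m/√m)/log 2`, `m ≥ 2`), `inv_sqrt_le_two_div_sqrt`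
  (`1/√n ≤ 2/√m` for `1 ≤ m ≤ 4n`), `log_two_div_sqrt_le` (`log 2/√M ≤ log m/√m` for `2 ≤ m ≤ M`).
* §2 THE ULTRAVIOLET END BELOW `k₀`.  `beta_ge_neg`: on the boxes `β_l(p) ≥ −(c₀ + C₁γ)` at EVERY index (split +
  (AF-0r) + (AF-1); `β⁰_∞ ≥ 0`).  `uv_invSq_lower`: THE ULTRAVIOLET LOWER PROFILE AT EVERY INDEX —
  `1/g_K(j)² ≥ b(K − k₀) − k₀(c₀ + C₁γ)` for `j ≤ k₀ ≤ K` (the quantitative content of gen 9's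
  `T4LambdaMatching.tendsto_run_zero`, there internal to a limit proof).  `uvDefect_eq_sum_add`:
  `δ_j = Σ_{l<d}(β⁰_{j+l} − β⁰_∞) + δ_{j+d}`.  THE REDUCTION TO INDEX `k₀` `matchErr_sub_matchErr_eq`: for `j ≤ k₀` and
  the run `K = j + m = k₀ + m'`, `[1/g_K(j)² − a⋆_m − δ_j] − [1/g_K(k₀)² − a⋆_{m'} − δ_{k₀}] = Σ_{i∈[j,k₀)} W_K(i)` — the
  matching error at index `j` IS the matching error at index `k₀` of the same run plus the `k₀ − j` scale defects in
  between (gen 10's bookkeeping identity `invSq_sub_astar_eq` twice; the one-loop parts are absorbed by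
  `δ_j − δ_{k₀}`).  `abs_scaleDefect_le_run`: `|W_K(i)| ≤ C₁g_K(i) + |b⋆_{K−1−i} − β⁰_∞|`; `abs_scaleDefect_le_uv`:
  for `i < k₀ ≤ K`, `1 ≤ m ≤ 2(K−k₀)`, `k₀(c₀+C₁γ) ≤ bm/4`: `|W_K(i)| ≤ 4C₁/(√b·√m)` (the lattice side by
  `uv_invSq_lower`, the continuum side by `T4ScaleMatchingRate.abs_bstar_sub_binf_le_inv_sqrt`);
  `abs_matchErr_le_crude`: at every index and distance `|1/g_{j+m}(j)² − a⋆_m − δ_j| ≤ m(2C/(1−θ⁺) + c₀) + c₀/(1−θ₀)`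
  (the geometric majorant `T4ScaleMatchingRate.abs_scaleDefect_le_geom` of every scale defect).
  **THE RATE AT EVERY ULTRAVIOLET INDEX, ONE CONSTANT** `abs_matchErr_le_unif`: **`∃ A ≥ 0, ∀ (family, pin, binders),
  ∀ j, ∀ m ≥ 2, |1/g_{j+m}(j)² − a⋆_m − δ_j| ≤ A·log m/√m`** — gen 10's `abs_invSq_sub_astar_sub_uvDefect_le_unif`
  WITHOUT the restriction `k₀ ≤ j` (three regimes: `j ≥ k₀` gen 10; `j < k₀` and `m < M₁ := max(2k₀+2,
  ⌈4k₀(c₀+C₁γ)/b⌉)` the crude bound; `j < k₀ ≤ j + m`, `m ≥ M₁` the reduction, with gen 10's rate at index `k₀` and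
  distance `m − (k₀−j) ≥ m/2` and at most `k₀` defects `≤ 4C₁/√(bm)` each; `A = 3A₁₀ + 4k₀C₁/(√b log 2) +
  (M₁(2C/(1−θ⁺)+c₀) + c₀/(1−θ₀))√M₁/log 2`, chosen BEFORE the family from `(C, θ, b, C₁, c₀, θ₀, γ, k₀)`);
  reindexed to whole runs `abs_run_matchErr_le_unif`: **`|1/g_K(i)² − a⋆_{K−i} − δ_i| ≤ A·log(K−i)/√(K−i)` for ALL
  `i ≤ K − 2`** — every lattice trajectory tracks the `δ`-shifted continuum trajectory DOWN TO THE BARE END with an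
  error depending only on the distance to the pin; `isBigO_matchErr` (the `O`-form at every `j`); and THE
  TWO-TRAJECTORY SCALE STEP AT EVERY INDEX `abs_twoRun_step_le_unif`: **`∃ A′ ≥ 0, ∀ (family, pin, binders), ∀ j,
  ∀ m ≥ 2, |1/g_{j+m+1}(j)² − 1/g_{j+m}(j)² − β⁰_∞| ≤ A′·log m/√m`** (`A′ = 3A + C₁/(√b log 2)`).
* §3 **THE BARE TWO-LOOP LAW WITH ITS CONSTANT, QUANTIFIED** `abs_bare_sub_lambdaLaw_le`: under gen 9's binders (those
  of §2 plus the two-loop split (TL)), **`∃ A ≥ 0, ∀ K ≥ 2, |1/g_K(0)² − (K·β⁰_∞ + (β¹¹_∞/β⁰_∞)·log K + Λ₀)| ≤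
  A·log K/√K`** (`A = A_§2 + contLambdaRate/log 2`, `contLambdaRate_nonneg`) — the matching rate at the bare end
  (`j = 0`, `m = K`) plus gen 9's continuum Λ-law `T4ContinuumLambda.abs_lambdaSeq_sub_contLambda_le` (`O(K^{−1/2})`),
  joined by `Λ₀ = Λ⋆ + δ₀`; `isBigO_bare_sub_lambdaLaw`: **`1/g_K(0)² − K·β⁰_∞ − (β¹¹_∞/β⁰_∞)·log K − Λ₀ =
  O(log K/√K)`** — gen 9's `tendsto_bareLambdaSeq` WITH A RATE.  Read with `K = log_L(a₀/ε)` scales between the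
  spacing `ε` and the unit scale, at fixed infrared datum: `1/g₀(ε)² = β⁰_∞·log_L(a₀/ε) + (β¹¹_∞/β⁰_∞)·log log_L(a₀/ε)
  + Λ₀ + O(log log(1/ε)/√log(1/ε))`.  The rate is that of the PROFILE piece `(AF-1)·g` of gen 10 and is NOT claimed
  optimal (the textbook's formal remainder in [Creutz2022] (13.19) is `O(g₀²) = O(1/K)`; reaching it would need the
  two-loop structure of the defects, not only the linear majorant (AF-1)).
* §4 THE CHART FORM `abs_invSq_bareOf_sub_lambdaLaw_le`: for a β with unique box continuation (`BackwardWP β γ q`,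
  gen 8) whose pinned family has node U2's output shape, gen 8's bare chart obeys `|1/ḡ₀(K,g)² − (K·β⁰_∞ +
  (β¹¹_∞/β⁰_∞)·log K + Λ₀)| ≤ A·log K/√K` (`K ≥ 2`); SANITY `example` (non-vacuity of the whole binder list): for the
  two-loop MARKOV family `β = b + c·p_k²` (`b > 0`, `c ≥ 0`, `2cγ(γ³ + 2γ/b) < 1/2`;
  `T4ContinuumTwoLoopLaw.backwardWP_twoLoopMarkov`, `pinnedRun`, `injectedRate_pinnedRun`) every binder holds for the
  pinned family of every datum `g_IR ∈ ]0,γ]` with `c₀ = 0`, `C₁ = cγ`, `k₀ = 0`, `C₃ = c₁ = 0`, `β¹¹_∞ = c`,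
  `InjectedRate 0 0 0`; `δ₀ = 0`, so `Λ₀ = Λ⋆` and `|1/g_K(0)² − (K·b + (c/b)·log K + Λ⋆)| ≤ A·log K/√K` for all `K ≥ 2`.

BINDERS (hypotheses of the theorems; NONE is a printed theorem for Bałaban's β-functions — each is an OPEN input of
the β-cell or of node U2, consumed BY NAME and never discharged here): the run-wise recursion (0.20) `RGEqH`, the box
`0 < g_K(i) ≤ γ`, the pin `g_K(K) = g_IR`; `EventualLowerH b γ k₀ β` with `b > 0` (GAPS G-t4-U2-1;
[Balaban1989LargeFieldII] p.355: the β-paper "has not been published yet"); node U2's OUTPUT SHAPE `InjectedRate C 0 θ`,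
`θ < 1` (GAPS G-t4-U2-2 — for history-dependent β this is the estimate NE4 itself; the wall (M) of the record
§4/§9/§12 — the two-history Lipschitz modulus of β, not printed — is untouched: this file CONSUMES the injected rate,
it does not produce it); the printed SPLIT SHAPE `B12Beta.OneLoopSplit β` ([Balaban1987RG1] (2.12)–(2.14) p.268) with
the UNPRINTED analytic inputs (AF-0r) IN RATE FORM `|β⁰_k − β⁰_∞| ≤ c₀θ₀^k`, `0 ≤ θ₀ < 1` (MISSING-B12 (M1), GAPS
G-b12-1) and (AF-1) `|β¹_{k+1}(p)| ≤ C₁p_k` on the box, `C₁ ≥ 0` (MISSING-B12 (M2), GAPS G-b12-2); §§3–4 ONLY: the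
two-loop split (TL) `|β¹_{k+1}(p) − β¹¹_∞p_k²| ≤ C₃p_k³ + c₁θ₁^k`, `C₃ ≥ 0`, `0 ≤ θ₁ < 1` (MISSING-B12 (M3), GAPS
G-b12-3).  The binder list of §2 is gen 10's, of §§3–4 gen 9's (`T4LambdaMatching.tendsto_bareLambdaSeq`, minus its
unused `0 ≤ c₁`); no new binder is introduced.

WHAT THIS IS NOT.  Not a statement about Bałaban's actual β-functions (every analytic input is a binder); not the
estimate NE4 / the wall (M) (InjectedRate is ASSUMED for the family; nothing here bounds the two-history mismatch of
β¹); not an optimal rate; not a comparison of two regularisation SCHEMES (one flow; "continuum" = the `n → ∞`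
diagonal limit of the SAME discrete recursion); not expectations, not the continuum limit of the MEASURES, not
infinite volume, mass gap, Clay or summit progress.  HONEST FRAMING: rung (B)+1, fixed finite T⁴, COUPLING CONSTANTS
only.

PRINTED ANCHORS (NEIGHBOURS for the SHAPE of the statements; used by no declaration; pages materialised with
`lit read doi:10.1007/bf01215223` / `lit read doi:10.1017/9781009290395` and grepped this session): [Balaban1987RG1]
p.256 (0.20) "the coupling constant g_{k+1} is determined from the equation" (the recursion); p.259 Theorem 2 with
(0.31) (the sequence `g_k ∈ ]0,γ]` pinned at `g_K = g`, two-sided profile bounds) and the sentence after it: "A proof of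
this theorem, based on perturbative calculations, will be given in a separate paper, where more precise asymptotic
behavior will be proved." (the deferral — the asymptotics and every rate are NOT PRINTED); p.268 (2.12)–(2.14) (the
split shape, `B12Beta`'s anchor); [Creutz2022] (13.19) p.65 `g₀^{−2} = γ₀ log(a^{−2}Λ₀^{−2}) + (γ₁/γ₀) log log(a^{−2}Λ₀^{−2})
+ O(g₀²)` and p.66 "the parameter Λ₀ represents a constant of integration" (the SHAPE of the bare two-loop law with
its constant; nothing of the textbook is used).

DECLARATIONS (18 theorems + 1 `example`; no `def`, no `structure`, no `sorry`, no `axiom`).  (§1)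
`inv_sqrt_le_log_div_sqrt`, `inv_sqrt_le_two_div_sqrt`, `log_two_div_sqrt_le`; (§2) `beta_ge_neg`, `uv_invSq_lower`,
`uvDefect_eq_sum_add`, `matchErr_sub_matchErr_eq`, `abs_scaleDefect_le_run`, `abs_matchErr_le_crude`,
`abs_scaleDefect_le_uv`, `abs_matchErr_le_unif`, `abs_run_matchErr_le_unif`, `isBigO_matchErr`,
`abs_twoRun_step_le_unif`; (§3) `contLambdaRate_nonneg`, `abs_bare_sub_lambdaLaw_le`, `isBigO_bare_sub_lambdaLaw`;
(§4) `abs_invSq_bareOf_sub_lambdaLaw_le`, the `example`.  Every theorem is [folklore] real analysis or bookkeeping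
unless its docstring carries a `[cite:]` locator, which then points at the printed SHAPE or SETTING only, as said
there.
-/

namespace Literature.MathematicalPhysics.QuantumFieldTheory.Balaban1983to89.T4BareLambdaRate

open Literature.MathematicalPhysics.QuantumFieldTheory.Balaban1983to89
open Literature.MathematicalPhysics.QuantumFieldTheory.Balaban1983to89.FlowStep
open Literature.MathematicalPhysics.QuantumFieldTheory.Balaban1983to89.T4CouplingMatching
open Literature.MathematicalPhysics.QuantumFieldTheory.Balaban1983to89.T4CauchySum (InjectedRate)
open Literature.MathematicalPhysics.QuantumFieldTheory.Balaban1983to89.T4BareCouplingChart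
open Literature.MathematicalPhysics.QuantumFieldTheory.Balaban1983to89.T4ContinuumCoupling
open Literature.MathematicalPhysics.QuantumFieldTheory.Balaban1983to89.T4OneLoopAsymptotics
open Literature.MathematicalPhysics.QuantumFieldTheory.Balaban1983to89.T4ContinuumTwoLoopLaw
open Literature.MathematicalPhysics.QuantumFieldTheory.Balaban1983to89.T4ContinuumLambda
open Literature.MathematicalPhysics.QuantumFieldTheory.Balaban1983to89.T4LambdaMatching
open Literature.MathematicalPhysics.QuantumFieldTheory.Balaban1983to89.T4ScaleMatchingRate
open Filter Topology Finset Asymptotics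

/-! ## §1 Elementary comparisons of the scale `log m/√m` -/

/-- `1/√m ≤ (log m/√m)/log 2` for `m ≥ 2`. [folklore] -/
theorem inv_sqrt_le_log_div_sqrt {m : ℕ} (hm : 2 ≤ m) :
    1 / Real.sqrt (m : ℝ) ≤ (Real.log m / Real.sqrt m) / Real.log 2 := by
  have hmr : (2 : ℝ) ≤ m := by exact_mod_cast hm
  have hlog2 : 0 < Real.log 2 := Real.log_pos one_lt_two
  have hlogm : Real.log 2 ≤ Real.log m := Real.log_le_log two_pos hmr
  have hs0 : 0 < Real.sqrt (m : ℝ) := Real.sqrt_pos.2 (by linarith)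
  rw [div_div, le_div_iff₀ (mul_pos hs0 hlog2)]
  have e : 1 / Real.sqrt (m : ℝ) * (Real.sqrt (m : ℝ) * Real.log 2) = Real.log 2 := by
    field_simp
  rw [e]
  exact hlogm

/-- `1/√n ≤ 2/√m` when `1 ≤ m ≤ 4n`. [folklore] -/
theorem inv_sqrt_le_two_div_sqrt {m n : ℕ} (hm : 1 ≤ m) (hmn : m ≤ 4 * n) :
    1 / Real.sqrt (n : ℝ) ≤ 2 / Real.sqrt (m : ℝ) := by
  have hn : 1 ≤ n := by omega
  have hnr : (1 : ℝ) ≤ n := by exact_mod_cast hn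
  have hmnr : (m : ℝ) ≤ 4 * n := by exact_mod_cast hmn
  have hsn : 0 < Real.sqrt (n : ℝ) := Real.sqrt_pos.2 (by linarith)
  have hmr : (0 : ℝ) < m := by exact_mod_cast hm
  have hsm : 0 < Real.sqrt (m : ℝ) := Real.sqrt_pos.2 hmr
  rw [div_le_div_iff₀ hsn hsm, one_mul]
  have h4 : Real.sqrt (m : ℝ) ≤ Real.sqrt (4 * n) := Real.sqrt_le_sqrt hmnr
  rw [Real.sqrt_mul (by norm_num), show Real.sqrt (4 : ℝ) = 2 by
    rw [show (4 : ℝ) = 2 ^ 2 by norm_num, Real.sqrt_sq (by norm_num)]] at h4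
  linarith

/-- On a bounded range of `m ≥ 2` the scale is bounded below: `m ≤ M ⇒ log 2/√M ≤ log m/√m`. [folklore] -/
theorem log_two_div_sqrt_le {m M : ℕ} (hm : 2 ≤ m) (hmM : m ≤ M) :
    Real.log 2 / Real.sqrt (M : ℝ) ≤ Real.log m / Real.sqrt m := by
  have hmr : (2 : ℝ) ≤ m := by exact_mod_cast hm
  have hmMr : (m : ℝ) ≤ M := by exact_mod_cast hmM
  have hlog2 : 0 < Real.log 2 := Real.log_pos one_lt_two
  have hlogm : Real.log 2 ≤ Real.log m := Real.log_le_log two_pos hmr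
  have hsm : 0 < Real.sqrt (m : ℝ) := Real.sqrt_pos.2 (by linarith)
  have hsM : Real.sqrt (m : ℝ) ≤ Real.sqrt (M : ℝ) := Real.sqrt_le_sqrt hmMr
  calc Real.log 2 / Real.sqrt (M : ℝ) ≤ Real.log 2 / Real.sqrt (m : ℝ) :=
        div_le_div_of_nonneg_left hlog2.le hsm hsM
    _ ≤ Real.log m / Real.sqrt m := div_le_div_of_nonneg_right hlogm hsm.le

section Matching

variable {β : HBeta} {g : ℕ → ℕ → ℝ} {γ gIR C θ b C₁ binf b1inf C₃ c₁ θ₁ c₀ θ₀ : ℝ} {k₀ : ℕ}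

/-! ## §2 The ultraviolet end below `k₀`: a lower profile, the reduction to index `k₀`, and the rate at EVERY index -/

/-- THE β-FUNCTIONS ARE BOUNDED BELOW ON THE BOXES, ALSO BELOW `k₀`: `β_l(p) ≥ −(c₀ + C₁γ)` — from the split,
(AF-0r) (`β⁰_l ≥ β⁰_∞ − c₀ ≥ −c₀` as `β⁰_∞ ≥ 0`) and (AF-1) (`β¹_l(p) ≥ −C₁p_l ≥ −C₁γ`).  ALL binders NOT PRINTED. [folklore] -/
theorem beta_ge_neg (S : B12Beta.OneLoopSplit β) (hC₁ : 0 ≤ C₁)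
    (hAF1 : ∀ k (p : Fin (k + 1) → ℝ), p ∈ Box γ k → |S.β1 k p| ≤ C₁ * p (Fin.last k))
    (hθ₀0 : 0 ≤ θ₀) (hθ₀1 : θ₀ < 1) (hrate : ∀ k, |S.β0 k - binf| ≤ c₀ * θ₀ ^ k) (hbinf : 0 ≤ binf)
    (l : ℕ) (p : Fin (l + 1) → ℝ) (hp : p ∈ Box γ l) : -(c₀ + C₁ * γ) ≤ β l p := by
  have hpl := (mem_box.1 hp) (Fin.last l)
  have hc₀ : 0 ≤ c₀ := by have := (abs_nonneg _).trans (hrate 0); simpa using this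
  have h0 : binf - c₀ ≤ S.β0 l := by
    have h := hrate l
    have hθl : θ₀ ^ l ≤ 1 := pow_le_one₀ hθ₀0 hθ₀1.le
    have : c₀ * θ₀ ^ l ≤ c₀ := by nlinarith
    linarith [(abs_le.1 h).1]
  have h1 : -(C₁ * γ) ≤ S.β1 l p := by
    have h := (abs_le.1 (hAF1 l p hp)).1
    nlinarith [hpl.2, hpl.1]
  rw [S.split l p]
  linarith

/-- THE ULTRAVIOLET LOWER PROFILE AT EVERY INDEX (also `j < k₀`): along a box run of (0.20) with `K ≥ k₀` steps,
`1/g_K(j)² ≥ b(K − k₀) − k₀(c₀ + C₁γ)` for every `j ≤ k₀` — the lower half of the discrete (0.31) from index `k₀` to the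
pin (`T4CouplingMatching.inv_sq_lower_of_eventualLower`) and at most `k₀` steps of a β bounded below by `−(c₀ + C₁γ)`
(`beta_ge_neg`).  The quantitative form of `T4LambdaMatching.tendsto_run_zero`. [cite: Balaban1987RG1, (0.31) p.259]
for the profile SHAPE only; every hypothesis is a NAMED BINDER, NOT PRINTED. -/
theorem uv_invSq_lower (S : B12Beta.OneLoopSplit β) {K : ℕ} {gs : ℕ → ℝ} (h : RGEqH K β gs)
    (hbox : ∀ i, i ≤ K → 0 < gs i ∧ gs i ≤ γ) (hlo : EventualLowerH b γ k₀ β) (hC₁ : 0 ≤ C₁)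
    (hAF1 : ∀ k (p : Fin (k + 1) → ℝ), p ∈ Box γ k → |S.β1 k p| ≤ C₁ * p (Fin.last k))
    (hθ₀0 : 0 ≤ θ₀) (hθ₀1 : θ₀ < 1) (hrate : ∀ k, |S.β0 k - binf| ≤ c₀ * θ₀ ^ k) (hbinf : 0 ≤ binf)
    {j : ℕ} (hj : j ≤ k₀) (hK : k₀ ≤ K) :
    b * ((K - k₀ : ℕ) : ℝ) - (k₀ : ℝ) * (c₀ + C₁ * γ) ≤ 1 / (gs j) ^ 2 := by
  have htel := inv_sq_telescopeH h hj hK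
  have hlow := inv_sq_lower_of_eventualLower h hbox hlo le_rfl hK
  have hposK : 0 ≤ 1 / (gs K) ^ 2 := by positivity
  have hsum : -(((k₀ - j : ℕ) : ℝ) * (c₀ + C₁ * γ)) ≤ ∑ l ∈ Ico j k₀, β l (prefixOf gs l) := by
    have h' := Finset.card_nsmul_le_sum (Ico j k₀) (fun l => β l (prefixOf gs l)) (-(c₀ + C₁ * γ))
      (fun l hl => beta_ge_neg S hC₁ hAF1 hθ₀0 hθ₀1 hrate hbinf l _
        (prefixOf_mem_box (((mem_Ico.1 hl).2.le).trans hK) hbox))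
    rw [Nat.card_Ico, nsmul_eq_mul] at h'
    linarith
  have hkj : ((k₀ - j : ℕ) : ℝ) ≤ (k₀ : ℝ) := by exact_mod_cast Nat.sub_le k₀ j
  have hγ : 0 ≤ γ := (hbox K le_rfl).1.le.trans (hbox K le_rfl).2
  have hc₀ : 0 ≤ c₀ := by have := (abs_nonneg _).trans (hrate 0); simpa using this
  have hB0 : 0 ≤ c₀ + C₁ * γ := by positivity
  rw [htel]
  nlinarith

/-- `δ_j = Σ_{l<d} (β⁰_{j+l} − β⁰_∞) + δ_{j+d}` (the one-loop ultraviolet defect splits at any later index). [folklore] -/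
theorem uvDefect_eq_sum_add (S : B12Beta.OneLoopSplit β) (hθ₀0 : 0 ≤ θ₀) (hθ₀1 : θ₀ < 1)
    (hrate : ∀ k, |S.β0 k - binf| ≤ c₀ * θ₀ ^ k) (j d : ℕ) :
    uvDefect S binf j = ∑ l ∈ range d, (S.β0 (j + l) - binf) + uvDefect S binf (j + d) := by
  have hs : Summable (fun l => S.β0 (j + l) - binf) := by
    have h := (summable_nat_add_iff j).2 (summable_beta0_sub S hθ₀0 hθ₀1 hrate)
    exact h.congr fun l => by rw [Nat.add_comm l j]
  have h := hs.sum_add_tsum_nat_add d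
  unfold uvDefect
  rw [← h]
  congr 1
  exact tsum_congr fun i => by rw [show j + (i + d) = j + d + i by omega]

/-- THE REDUCTION TO INDEX `k₀`: for `j ≤ k₀` and the run with `K = j + (d + m')` steps, `d = k₀ − j`,
`[1/g_K(j)² − a⋆_{d+m'} − δ_j] − [1/g_K(k₀)² − a⋆_{m'} − δ_{k₀}] = Σ_{i∈[j,k₀)} W_K(i)` — the matching error at index
`j` is the matching error at index `k₀` of the SAME run plus the `k₀ − j` scale defects in between (the one-loop
parts are absorbed by `δ_j − δ_{k₀}`). [folklore] -/
theorem matchErr_sub_matchErr_eq (S : B12Beta.OneLoopSplit β) (hθ1 : θ < 1)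
    (hinj : InjectedRate C 0 θ (fun K j => disc (g K) (g (K + 1)) j)) (hrun : ∀ K, RGEqH K β (g K))
    (hpin : ∀ K, g K K = gIR) (hθ₀0 : 0 ≤ θ₀) (hθ₀1 : θ₀ < 1) (hrate : ∀ k, |S.β0 k - binf| ≤ c₀ * θ₀ ^ k)
    {j : ℕ} (hj : j ≤ k₀) (m' : ℕ) :
    (invSq g (k₀ - j + m') j - astar g (k₀ - j + m') - uvDefect S binf j) -
        (invSq g m' k₀ - astar g m' - uvDefect S binf k₀) =
      ∑ l ∈ range (k₀ - j), scaleDefect S g binf (k₀ + m') (j + l) := by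
  set d : ℕ := k₀ - j with hd
  have hjd : j + d = k₀ := by omega
  have hK : j + (d + m') = k₀ + m' := by omega
  rw [invSq_sub_astar_eq S hθ1 hinj hrun hpin (d + m') j, invSq_sub_astar_eq S hθ1 hinj hrun hpin m' k₀,
    uvDefect_eq_sum_add S hθ₀0 hθ₀1 hrate j d, hjd, sum_range_add, sum_range_add, hK]
  have e1 : ∑ x ∈ range m', (S.β0 (j + (d + x)) - binf) = ∑ x ∈ range m', (S.β0 (k₀ + x) - binf) :=
    sum_congr rfl fun x _ => by rw [show j + (d + x) = k₀ + x by omega]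
  have e2 : ∑ x ∈ range m', scaleDefect S g binf (k₀ + m') (j + (d + x)) =
      ∑ x ∈ range m', scaleDefect S g binf (k₀ + m') (k₀ + x) :=
    sum_congr rfl fun x _ => by rw [show j + (d + x) = k₀ + x by omega]
  rw [e1, e2]
  ring

/-- THE SCALE DEFECT BELOW `k₀` IS PAID WITH THE COUPLING ITSELF: for `i ≤ K − 1`,
`|W_K(i)| ≤ C₁·g_K(i) + |b⋆_{K−1−i} − β⁰_∞|` ((AF-1) on the lattice trajectory; the continuum term untouched). [folklore] -/
theorem abs_scaleDefect_le_run (S : B12Beta.OneLoopSplit β)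
    (hbox : ∀ K i, i ≤ K → 0 < g K i ∧ g K i ≤ γ)
    (hAF1 : ∀ k (p : Fin (k + 1) → ℝ), p ∈ Box γ k → |S.β1 k p| ≤ C₁ * p (Fin.last k)) {K i : ℕ} (hiK : i ≤ K) :
    |scaleDefect S g binf K i| ≤ C₁ * g K i + |bstar g (K - 1 - i) - binf| := by
  have ha : |S.β1 i (prefixOf (g K) i)| ≤ C₁ * g K i := by
    simpa using hAF1 i _ (prefixOf_mem_box hiK (hbox K))
  unfold scaleDefect
  exact (abs_sub _ _).trans (add_le_add ha le_rfl)

/-- A CRUDE BOUND AT EVERY INDEX AND DISTANCE (no rate): `|1/g_{j+m}(j)² − a⋆_m − δ_j| ≤ m·(2C/(1−θ⁺) + c₀) + c₀/(1−θ₀)`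
(`θ⁺ = max θ 0`) — the bookkeeping identity with the GEOMETRIC majorant of every scale defect
(`T4ScaleMatchingRate.abs_scaleDefect_le_geom`) and the tail of (AF-0r). [folklore] -/
theorem abs_matchErr_le_crude (S : B12Beta.OneLoopSplit β) (hθ1 : θ < 1)
    (hinj : InjectedRate C 0 θ (fun K j => disc (g K) (g (K + 1)) j)) (hrun : ∀ K, RGEqH K β (g K))
    (hpin : ∀ K, g K K = gIR) (hθ₀0 : 0 ≤ θ₀) (hθ₀1 : θ₀ < 1) (hrate : ∀ k, |S.β0 k - binf| ≤ c₀ * θ₀ ^ k)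
    (j m : ℕ) :
    |invSq g m j - astar g m - uvDefect S binf j| ≤
      (m : ℝ) * (2 * C / (1 - max θ 0) + c₀) + c₀ / (1 - θ₀) := by
  set θ' : ℝ := max θ 0 with hθ'
  have hθ'0 : 0 ≤ θ' := le_max_right _ _
  have hθ'1 : θ' < 1 := max_lt hθ1 one_pos
  have h1θ' : 0 < 1 - θ' := by linarith
  have h1θ₀ : 0 < 1 - θ₀ := by linarith
  have hinj' := injectedRate_max_zero hinj
  have hC0 : 0 ≤ C := by simpa using hinj.const_nonneg 0
  have hc₀ : 0 ≤ c₀ := by have := (abs_nonneg _).trans (hrate 0); simpa using this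
  -- every scale defect is at most 2C/(1−θ⁺) + c₀
  have hW : ∀ l, l < m → |scaleDefect S g binf (j + m) (j + l)| ≤ 2 * C / (1 - θ') + c₀ := by
    intro l hl
    have h := abs_scaleDefect_le_geom S hθ'1 hinj' hrun hrate (binf := binf) (by omega : j + l < j + m)
    have p1 : θ' ^ (j + l) ≤ 1 := pow_le_one₀ hθ'0 hθ'1.le
    have p2 : θ' ^ (j + l + 1) ≤ 1 := pow_le_one₀ hθ'0 hθ'1.le
    have p3 : θ₀ ^ (j + l) ≤ 1 := pow_le_one₀ hθ₀0 hθ₀1.le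
    have q1 : C * θ' ^ (j + l) / (1 - θ') ≤ C / (1 - θ') :=
      div_le_div_of_nonneg_right (by nlinarith) h1θ'.le
    have q2 : C * θ' ^ (j + l + 1) / (1 - θ') ≤ C / (1 - θ') :=
      div_le_div_of_nonneg_right (by nlinarith) h1θ'.le
    have q3 : c₀ * θ₀ ^ (j + l) ≤ c₀ := by nlinarith
    calc |scaleDefect S g binf (j + m) (j + l)|
        ≤ C * θ' ^ (j + l) / (1 - θ') + C * θ' ^ (j + l + 1) / (1 - θ') + c₀ * θ₀ ^ (j + l) := h
      _ ≤ C / (1 - θ') + C / (1 - θ') + c₀ := add_le_add (add_le_add q1 q2) q3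
      _ = 2 * C / (1 - θ') + c₀ := by ring
  have hsumW : |∑ l ∈ range m, scaleDefect S g binf (j + m) (j + l)| ≤ (m : ℝ) * (2 * C / (1 - θ') + c₀) := by
    refine (abs_sum_le_sum_abs _ _).trans ?_
    have h := Finset.sum_le_card_nsmul (range m) (fun l => |scaleDefect S g binf (j + m) (j + l)|)
      (2 * C / (1 - θ') + c₀) (fun l hl => hW l (mem_range.1 hl))
    rw [card_range, nsmul_eq_mul] at h
    exact h
  have htail := abs_sum_range_sub_uvDefect_le S hθ₀0 hθ₀1 hrate j m (binf := binf)
  have htail' : |∑ l ∈ range m, (S.β0 (j + l) - binf) - uvDefect S binf j| ≤ c₀ / (1 - θ₀) := by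
    refine htail.trans (div_le_div_of_nonneg_right ?_ h1θ₀.le)
    have : θ₀ ^ (j + m) ≤ 1 := pow_le_one₀ hθ₀0 hθ₀1.le
    nlinarith
  rw [invSq_sub_astar_eq S hθ1 hinj hrun hpin m j (binf := binf)]
  have e : ∑ l ∈ range m, (S.β0 (j + l) - binf) + ∑ l ∈ range m, scaleDefect S g binf (j + m) (j + l) -
      uvDefect S binf j = (∑ l ∈ range m, (S.β0 (j + l) - binf) - uvDefect S binf j) +
      ∑ l ∈ range m, scaleDefect S g binf (j + m) (j + l) := by ring
  rw [e]
  exact (abs_add_le _ _).trans (by linarith)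

/-- THE SCALE DEFECT BELOW `k₀`, QUANTIFIED: for `i < k₀ ≤ K` and a distance parameter `m ≥ 1` with `m ≤ 2(K − k₀)` and
`k₀(c₀ + C₁γ) ≤ bm/4`, `|W_K(i)| ≤ 4C₁/(√b·√m)` — the lattice side by the ultraviolet lower profile (`uv_invSq_lower`:
`1/g_K(i)² ≥ b(K−k₀) − k₀(c₀+C₁γ) ≥ bm/4`), the continuum side by
`T4ScaleMatchingRate.abs_bstar_sub_binf_le_inv_sqrt` (`K − 1 − i ≥ K − k₀ ≥ m/4`). [folklore] -/
theorem abs_scaleDefect_le_uv (S : B12Beta.OneLoopSplit β) (hθ1 : θ < 1)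
    (hinj : InjectedRate C 0 θ (fun K j => disc (g K) (g (K + 1)) j)) (hrun : ∀ K, RGEqH K β (g K))
    (hbox : ∀ K i, i ≤ K → 0 < g K i ∧ g K i ≤ γ) (hpin : ∀ K, g K K = gIR)
    (hb : 0 < b) (hlo : EventualLowerH b γ k₀ β) (hC₁ : 0 ≤ C₁)
    (hAF1 : ∀ k (p : Fin (k + 1) → ℝ), p ∈ Box γ k → |S.β1 k p| ≤ C₁ * p (Fin.last k))
    (hθ₀0 : 0 ≤ θ₀) (hθ₀1 : θ₀ < 1) (hrate : ∀ k, |S.β0 k - binf| ≤ c₀ * θ₀ ^ k) {K i m : ℕ} (hi : i < k₀)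
    (hK : k₀ ≤ K) (hm1 : 1 ≤ m) (h2 : m ≤ 2 * (K - k₀)) (hkB : (k₀ : ℝ) * (c₀ + C₁ * γ) ≤ b * m / 4) :
    |scaleDefect S g binf K i| ≤ 4 * C₁ / (Real.sqrt b * Real.sqrt m) := by
  have hγ : 0 < γ := (hbox 0 0 le_rfl).1.trans_le (hbox 0 0 le_rfl).2
  have hconv : Tendsto S.β0 atTop (𝓝 binf) := tendsto_of_abs_sub_le_geom hθ₀0 hθ₀1 hrate
  have hbinf : 0 ≤ binf := hb.le.trans (af_le_binf S hγ hlo hAF1 hconv)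
  have hsb : 0 < Real.sqrt b := Real.sqrt_pos.2 hb
  have hmr : (1 : ℝ) ≤ m := by exact_mod_cast hm1
  have hm0 : (0 : ℝ) < m := by linarith
  have hiK : i ≤ K := by omega
  have h1 := abs_scaleDefect_le_run S hbox hAF1 hiK (binf := binf) (g := g)
  -- the lattice side: `g_K(i) ≤ 2/(√b√m)`
  have hlowi := uv_invSq_lower S (hrun K) (hbox K) hlo hC₁ hAF1 hθ₀0 hθ₀1 hrate hbinf hi.le hK
  have h2r : (m : ℝ) ≤ 2 * ((K - k₀ : ℕ) : ℝ) := by exact_mod_cast h2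
  have hquarter : b * m / 4 ≤ 1 / (g K i) ^ 2 := by nlinarith
  have hG0 := (hbox K i hiK).1
  have hbm : 0 < b * m / 4 := by positivity
  have hsq : (g K i) ^ 2 ≤ 1 / (b * m / 4) := by
    have h := one_div_le_one_div_of_le hbm hquarter
    rwa [one_div_one_div] at h
  have hGle : g K i ≤ 2 / (Real.sqrt b * Real.sqrt m) := by
    have h := le_one_div_sqrt_of_sq_le hbm hsq
    have e : b * m / 4 = (Real.sqrt b * Real.sqrt m / 2) ^ 2 := by
      rw [div_pow, mul_pow, Real.sq_sqrt hb.le, Real.sq_sqrt hm0.le]; ring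
    rw [e, Real.sqrt_sq (by positivity)] at h
    calc g K i ≤ 1 / (Real.sqrt b * Real.sqrt m / 2) := h
      _ = 2 / (Real.sqrt b * Real.sqrt m) := by field_simp
  -- the continuum side: `|b⋆_{K−1−i} − β⁰_∞| ≤ C₁/(√b√(K−1−i)) ≤ 2C₁/(√b√m)`
  have hn1 : 1 ≤ K - 1 - i := by omega
  have hbst := abs_bstar_sub_binf_le_inv_sqrt S hθ1 hinj hrun hbox hpin hb hlo hC₁ hAF1 hθ₀0 hθ₀1 hrate hn1
  have hs2 := inv_sqrt_le_two_div_sqrt (m := m) (n := K - 1 - i) hm1 (by omega)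
  have hbst' : |bstar g (K - 1 - i) - binf| ≤ 2 * C₁ / (Real.sqrt b * Real.sqrt m) := by
    refine hbst.trans ?_
    have h := mul_le_mul_of_nonneg_left hs2 (div_nonneg hC₁ hsb.le : 0 ≤ C₁ / Real.sqrt b)
    calc C₁ / (Real.sqrt b * Real.sqrt ((K - 1 - i : ℕ) : ℝ))
        = C₁ / Real.sqrt b * (1 / Real.sqrt ((K - 1 - i : ℕ) : ℝ)) := by ring
      _ ≤ C₁ / Real.sqrt b * (2 / Real.sqrt m) := h
      _ = 2 * C₁ / (Real.sqrt b * Real.sqrt m) := by ring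
  calc |scaleDefect S g binf K i| ≤ C₁ * g K i + |bstar g (K - 1 - i) - binf| := h1
    _ ≤ C₁ * (2 / (Real.sqrt b * Real.sqrt m)) + 2 * C₁ / (Real.sqrt b * Real.sqrt m) :=
        add_le_add (mul_le_mul_of_nonneg_left hGle hC₁) hbst'
    _ = 4 * C₁ / (Real.sqrt b * Real.sqrt m) := by ring

/-- **THE `O(log m/√m)` LAW OF THE MATCHING AT EVERY ULTRAVIOLET INDEX, ONE CONSTANT** (this file's extension of
`T4ScaleMatchingRate.abs_invSq_sub_astar_sub_uvDefect_le_unif`, which had `k₀ ≤ j`): ONE constant `A`, chosen from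
`(C, θ, b, C₁, c₀, θ₀, γ, k₀)` BEFORE the family, such that for every pinned family of box runs with node U2's output
shape, EVERY ultraviolet index `j` (also `j < k₀`, where no lower bound on `β` is assumed) and every distance `m ≥ 2`:
**`|1/g_{j+m}(j)² − a⋆_m − δ_j| ≤ A·log m/√m`**.  Below `k₀` the error at index `j` is the error at index `k₀` of the
same run (gen 10's rate at distance `m − (k₀ − j) ≥ m/2`) plus at most `k₀` scale defects, each `≤ 4C₁/√(bm)` by the
ultraviolet lower profile `uv_invSq_lower` on the lattice side and `T4ScaleMatchingRate.abs_bstar_sub_binf_le_inv_sqrt`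
on the continuum side (`matchErr_sub_matchErr_eq`, `abs_scaleDefect_le_run`); distances `m < M₁ :=
max(2k₀+2, ⌈4k₀(c₀+C₁γ)/b⌉)` are paid with the crude bound `abs_matchErr_le_crude`.  Explicitly
`A = 3A₁₀ + 4k₀C₁/(√b·log 2) + (M₁(2C/(1−θ⁺)+c₀) + c₀/(1−θ₀))·√M₁/log 2` with `A₁₀` gen 10's constant. [folklore] -/
theorem abs_matchErr_le_unif (S : B12Beta.OneLoopSplit β) (hθ1 : θ < 1) (hb : 0 < b)
    (hlo : EventualLowerH b γ k₀ β) (hC₁ : 0 ≤ C₁)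
    (hAF1 : ∀ k (p : Fin (k + 1) → ℝ), p ∈ Box γ k → |S.β1 k p| ≤ C₁ * p (Fin.last k))
    (hθ₀0 : 0 ≤ θ₀) (hθ₀1 : θ₀ < 1) (hrate : ∀ k, |S.β0 k - binf| ≤ c₀ * θ₀ ^ k) :
    ∃ A : ℝ, 0 ≤ A ∧ ∀ (G : ℕ → ℕ → ℝ) (gir : ℝ), InjectedRate C 0 θ (fun K j => disc (G K) (G (K + 1)) j) →
      (∀ K, RGEqH K β (G K)) → (∀ K i, i ≤ K → 0 < G K i ∧ G K i ≤ γ) → (∀ K, G K K = gir) →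
      ∀ (j : ℕ) ⦃m : ℕ⦄, 2 ≤ m →
        |invSq G m j - astar G m - uvDefect S binf j| ≤ A * (Real.log m / Real.sqrt m) := by
  obtain ⟨A, hA0, hA⟩ :=
    abs_invSq_sub_astar_sub_uvDefect_le_unif (C := C) S hθ1 hb hlo hC₁ hAF1 hθ₀0 hθ₀1 hrate
  -- constants chosen BEFORE the family
  have hc₀ : 0 ≤ c₀ := by have := (abs_nonneg _).trans (hrate 0); simpa using this
  have hlog2 : 0 < Real.log 2 := Real.log_pos one_lt_two
  have h1θ₀ : 0 < 1 - θ₀ := by linarith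
  set θ' : ℝ := max θ 0 with hθ'
  have hθ'1 : θ' < 1 := max_lt hθ1 one_pos
  have h1θ' : 0 < 1 - θ' := by linarith
  set Cp : ℝ := max C 0 with hCp
  have hCp0 : 0 ≤ Cp := le_max_right _ _
  set B : ℝ := c₀ + C₁ * γ with hB
  set M₁ : ℕ := max (2 * k₀ + 2) ⌈4 * k₀ * B / b⌉₊ with hM₁
  have hM₁k : 2 * k₀ + 2 ≤ M₁ := le_max_left _ _
  have hM₁B : 4 * k₀ * B / b ≤ (M₁ : ℝ) := by
    have h1 : ⌈4 * (k₀ : ℝ) * B / b⌉₊ ≤ M₁ := le_max_right _ _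
    have h2 : ((⌈4 * (k₀ : ℝ) * B / b⌉₊ : ℕ) : ℝ) ≤ (M₁ : ℝ) := by exact_mod_cast h1
    exact (Nat.le_ceil _).trans h2
  have hM₁2 : (2 : ℝ) ≤ (M₁ : ℝ) := by exact_mod_cast (show 2 ≤ M₁ by omega)
  have hM₁0 : (0 : ℝ) < M₁ := by linarith
  have hsM₁ : 0 < Real.sqrt (M₁ : ℝ) := Real.sqrt_pos.2 hM₁0
  set W₀ : ℝ := 2 * Cp / (1 - θ') + c₀ with hW₀
  have hW₀0 : 0 ≤ W₀ := by rw [hW₀]; positivity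
  set B₁ : ℝ := (M₁ : ℝ) * W₀ + c₀ / (1 - θ₀) with hB₁
  have hB₁0 : 0 ≤ B₁ := by rw [hB₁]; positivity
  have hsb : 0 < Real.sqrt b := Real.sqrt_pos.2 hb
  set A' : ℝ := 3 * A + 4 * k₀ * C₁ / (Real.sqrt b * Real.log 2) + B₁ * (Real.sqrt M₁ / Real.log 2) with hA'
  have hmid0 : 0 ≤ 4 * k₀ * C₁ / (Real.sqrt b * Real.log 2) := by positivity
  have hlast0 : 0 ≤ B₁ * (Real.sqrt M₁ / Real.log 2) := by positivity
  have hA'0 : 0 ≤ A' := by rw [hA']; positivity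
  refine ⟨A', hA'0, ?_⟩
  -- now the family
  intro G gir hinj hrun hbox hpin j m hm2
  have hmr : (2 : ℝ) ≤ m := by exact_mod_cast hm2
  have hm0 : (0 : ℝ) < m := by linarith
  have hlogm : Real.log 2 ≤ Real.log m := Real.log_le_log two_pos hmr
  have hlogm0 : 0 ≤ Real.log m := hlog2.le.trans hlogm
  have hs0 : 0 < Real.sqrt (m : ℝ) := Real.sqrt_pos.2 hm0
  have hu0 : 0 ≤ Real.log m / Real.sqrt m := div_nonneg hlogm0 hs0.le
  have hC0 : 0 ≤ C := by simpa using hinj.const_nonneg 0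
  have hCpC : Cp = C := max_eq_left hC0
  rcases le_or_gt k₀ j with hk₀ | hjk
  · -- `j ≥ k₀`: gen 10's uniform rate
    have h := hA G gir hinj hrun hbox hpin hk₀ hm2
    have hAA' : A ≤ A' := by rw [hA']; linarith only [hA0, hmid0, hlast0]
    exact h.trans (mul_le_mul_of_nonneg_right hAA' hu0)
  rcases lt_or_ge m M₁ with hmM | hMm
  · -- `j < k₀`, `m < M₁`: the crude bound
    have h := abs_matchErr_le_crude S hθ1 hinj hrun hpin hθ₀0 hθ₀1 hrate j m (binf := binf) (g := G)
    have hW₀C : W₀ = 2 * C / (1 - θ') + c₀ := by rw [hW₀, hCpC]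
    rw [← hW₀C] at h
    have hmM' : (m : ℝ) ≤ M₁ := by exact_mod_cast hmM.le
    have h1 : (m : ℝ) * W₀ + c₀ / (1 - θ₀) ≤ B₁ := by
      have h0 := mul_le_mul_of_nonneg_right hmM' hW₀0
      rw [hB₁]; linarith only [h0]
    have hl := log_two_div_sqrt_le hm2 hmM.le
    have h2 : B₁ ≤ B₁ * (Real.sqrt M₁ / Real.log 2) * (Real.log m / Real.sqrt m) := by
      calc B₁ = B₁ * (Real.sqrt M₁ / Real.log 2) * (Real.log 2 / Real.sqrt M₁) := by
            field_simp
        _ ≤ B₁ * (Real.sqrt M₁ / Real.log 2) * (Real.log m / Real.sqrt m) :=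
            mul_le_mul_of_nonneg_left hl (by positivity)
    have hBA' : B₁ * (Real.sqrt M₁ / Real.log 2) ≤ A' := by rw [hA']; linarith only [hA0, hmid0]
    exact h.trans (h1.trans (h2.trans (mul_le_mul_of_nonneg_right hBA' hu0)))
  · -- `j < k₀`, `m ≥ M₁`: reduction to index `k₀`
    obtain ⟨m', hm'⟩ : ∃ m', m = k₀ - j + m' := ⟨m - (k₀ - j), by omega⟩
    have h2m' : m ≤ 2 * m' := by omega
    have hm'2 : 2 ≤ m' := by omega
    have hm'm : m' ≤ m := by omega
    have hm'r : (2 : ℝ) ≤ m' := by exact_mod_cast hm'2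
    have hm'0 : (0 : ℝ) < m' := by linarith
    set K : ℕ := k₀ + m' with hK
    -- the identity
    have hid := matchErr_sub_matchErr_eq S hθ1 hinj hrun hpin hθ₀0 hθ₀1 hrate hjk.le m' (binf := binf) (g := G)
    rw [← hm'] at hid
    -- the main term, at index `k₀` and distance `m'`
    have hmain := hA G gir hinj hrun hbox hpin le_rfl hm'2
    have hcmp : Real.log (m' : ℝ) / Real.sqrt m' ≤ 2 * (Real.log m / Real.sqrt m) := by
      have hl : Real.log (m' : ℝ) ≤ Real.log m := Real.log_le_log hm'0 (by exact_mod_cast hm'm)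
      have hl0 : 0 ≤ Real.log (m' : ℝ) := hlog2.le.trans (Real.log_le_log two_pos hm'r)
      have hs := inv_sqrt_le_two_div_sqrt (m := m) (n := m') (by omega) (by omega)
      calc Real.log (m' : ℝ) / Real.sqrt m' = Real.log (m' : ℝ) * (1 / Real.sqrt m') := by ring
        _ ≤ Real.log m * (2 / Real.sqrt m) := mul_le_mul hl hs (by positivity) hlogm0
        _ = 2 * (Real.log m / Real.sqrt m) := by ring
    have hmain' : |invSq G m' k₀ - astar G m' - uvDefect S binf k₀| ≤ 2 * A * (Real.log m / Real.sqrt m) := by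
      refine hmain.trans ?_
      have h := mul_le_mul_of_nonneg_left hcmp hA0
      linarith only [h]
    -- the scale defects in between
    have hMm' : (M₁ : ℝ) ≤ m := by exact_mod_cast hMm
    have hkB : (k₀ : ℝ) * (c₀ + C₁ * γ) ≤ b * m / 4 := by
      have h := hM₁B
      rw [div_le_iff₀ hb] at h
      have h' : (M₁ : ℝ) * b ≤ m * b := mul_le_mul_of_nonneg_right hMm' hb.le
      rw [hB] at h
      linarith
    have hWi : ∀ l, l < k₀ - j → |scaleDefect S G binf K (j + l)| ≤ 4 * C₁ / (Real.sqrt b * Real.sqrt m) :=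
      fun l hl => abs_scaleDefect_le_uv S hθ1 hinj hrun hbox hpin hb hlo hC₁ hAF1 hθ₀0 hθ₀1 hrate
        (by omega : j + l < k₀) (by omega : k₀ ≤ K) (by omega : 1 ≤ m) (by omega : m ≤ 2 * (K - k₀)) hkB
    have hsumW : |∑ l ∈ range (k₀ - j), scaleDefect S G binf K (j + l)| ≤
        (k₀ : ℝ) * (4 * C₁ / (Real.sqrt b * Real.sqrt m)) := by
      refine (abs_sum_le_sum_abs _ _).trans ?_
      have h := Finset.sum_le_card_nsmul (range (k₀ - j)) (fun l => |scaleDefect S G binf K (j + l)|)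
        (4 * C₁ / (Real.sqrt b * Real.sqrt m)) (fun l hl => hWi l (mem_range.1 hl))
      rw [card_range, nsmul_eq_mul] at h
      refine h.trans (mul_le_mul_of_nonneg_right ?_ (by positivity))
      exact_mod_cast Nat.sub_le k₀ j
    have hsumW' : (k₀ : ℝ) * (4 * C₁ / (Real.sqrt b * Real.sqrt m)) ≤
        4 * k₀ * C₁ / (Real.sqrt b * Real.log 2) * (Real.log m / Real.sqrt m) := by
      have h := mul_le_mul_of_nonneg_left (inv_sqrt_le_log_div_sqrt hm2)
        (by positivity : 0 ≤ 4 * k₀ * C₁ / Real.sqrt b)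
      calc (k₀ : ℝ) * (4 * C₁ / (Real.sqrt b * Real.sqrt m))
          = 4 * k₀ * C₁ / Real.sqrt b * (1 / Real.sqrt m) := by ring
        _ ≤ 4 * k₀ * C₁ / Real.sqrt b * ((Real.log m / Real.sqrt m) / Real.log 2) := h
        _ = 4 * k₀ * C₁ / (Real.sqrt b * Real.log 2) * (Real.log m / Real.sqrt m) := by ring
    -- assemble
    have hK' : K = k₀ + m' := rfl
    have e : invSq G m j - astar G m - uvDefect S binf j =
        (invSq G m' k₀ - astar G m' - uvDefect S binf k₀) +
          ∑ l ∈ range (k₀ - j), scaleDefect S G binf K (j + l) := by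
      rw [hK']; linear_combination hid
    rw [e]
    have hfin : 2 * A * (Real.log m / Real.sqrt m) +
        4 * k₀ * C₁ / (Real.sqrt b * Real.log 2) * (Real.log m / Real.sqrt m) ≤ A' * (Real.log m / Real.sqrt m) := by
      have hle : 2 * A + 4 * k₀ * C₁ / (Real.sqrt b * Real.log 2) ≤ A' := by
        rw [hA']; linarith only [hA0, hlast0]
      have h := mul_le_mul_of_nonneg_right hle hu0
      linarith only [h]
    exact (abs_add_le _ _).trans ((add_le_add hmain' (hsumW.trans hsumW')).trans hfin)

/-- **THE WHOLE TRAJECTORY, DOWN TO THE BARE END** (`abs_matchErr_le_unif` reindexed, `m = K − i`): ONE constant such that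
for every pinned family, every run `K` and EVERY index `i ≤ K − 2` (also `i < k₀`):
`|1/g_K(i)² − a⋆_{K−i} − δ_i| ≤ A·log(K−i)/√(K−i)` — gen 10's `abs_run_sub_astar_sub_uvDefect_le_unif` without the
restriction `k₀ ≤ i`. [folklore] -/
theorem abs_run_matchErr_le_unif (S : B12Beta.OneLoopSplit β) (hθ1 : θ < 1) (hb : 0 < b)
    (hlo : EventualLowerH b γ k₀ β) (hC₁ : 0 ≤ C₁)
    (hAF1 : ∀ k (p : Fin (k + 1) → ℝ), p ∈ Box γ k → |S.β1 k p| ≤ C₁ * p (Fin.last k))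
    (hθ₀0 : 0 ≤ θ₀) (hθ₀1 : θ₀ < 1) (hrate : ∀ k, |S.β0 k - binf| ≤ c₀ * θ₀ ^ k) :
    ∃ A : ℝ, 0 ≤ A ∧ ∀ (G : ℕ → ℕ → ℝ) (gir : ℝ), InjectedRate C 0 θ (fun K j => disc (G K) (G (K + 1)) j) →
      (∀ K, RGEqH K β (G K)) → (∀ K i, i ≤ K → 0 < G K i ∧ G K i ≤ γ) → (∀ K, G K K = gir) →
      ∀ ⦃K i : ℕ⦄, i + 2 ≤ K →
        |1 / (G K i) ^ 2 - astar G (K - i) - uvDefect S binf i| ≤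
          A * (Real.log ((K - i : ℕ) : ℝ) / Real.sqrt ((K - i : ℕ) : ℝ)) := by
  obtain ⟨A, hA0, hA⟩ := abs_matchErr_le_unif (C := C) S hθ1 hb hlo hC₁ hAF1 hθ₀0 hθ₀1 hrate
  refine ⟨A, hA0, ?_⟩
  intro G gir hinj hrun hbox hpin K i hiK
  have h := hA G gir hinj hrun hbox hpin i (m := K - i) (by omega)
  have e : i + (K - i) = K := by omega
  have e2 : invSq G (K - i) i = 1 / (G K i) ^ 2 := by unfold invSq; rw [e]
  rw [e2] at h
  exact h

/-- The `O`-form at EVERY ultraviolet index (gen 10's `isBigO_invSq_sub_astar_sub_uvDefect` without `k₀ ≤ j`):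
`1/g_{j+m}(j)² − a⋆_m − δ_j = O(log m/√m)`. [folklore] -/
theorem isBigO_matchErr (S : B12Beta.OneLoopSplit β) (hθ1 : θ < 1)
    (hinj : InjectedRate C 0 θ (fun K j => disc (g K) (g (K + 1)) j)) (hrun : ∀ K, RGEqH K β (g K))
    (hbox : ∀ K i, i ≤ K → 0 < g K i ∧ g K i ≤ γ) (hpin : ∀ K, g K K = gIR)
    (hb : 0 < b) (hlo : EventualLowerH b γ k₀ β) (hC₁ : 0 ≤ C₁)
    (hAF1 : ∀ k (p : Fin (k + 1) → ℝ), p ∈ Box γ k → |S.β1 k p| ≤ C₁ * p (Fin.last k))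
    (hθ₀0 : 0 ≤ θ₀) (hθ₀1 : θ₀ < 1) (hrate : ∀ k, |S.β0 k - binf| ≤ c₀ * θ₀ ^ k) (j : ℕ) :
    (fun m : ℕ => invSq g m j - astar g m - uvDefect S binf j) =O[atTop]
      (fun m : ℕ => Real.log (m : ℝ) / Real.sqrt (m : ℝ)) := by
  obtain ⟨A, -, hA⟩ := abs_matchErr_le_unif (C := C) S hθ1 hb hlo hC₁ hAF1 hθ₀0 hθ₀1 hrate
  refine IsBigO.of_bound A ?_
  filter_upwards [eventually_ge_atTop 2] with m hm
  have hmr : (2 : ℝ) ≤ m := by exact_mod_cast hm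
  have hu0 : 0 ≤ Real.log m / Real.sqrt m :=
    div_nonneg ((Real.log_pos one_lt_two).le.trans (Real.log_le_log two_pos hmr)) (Real.sqrt_nonneg _)
  rw [Real.norm_eq_abs, Real.norm_eq_abs, abs_of_nonneg hu0]
  exact hA g gIR hinj hrun hbox hpin j hm

/-- **THE TWO-TRAJECTORY SCALE STEP AT EVERY INDEX, ONE CONSTANT** (gen 10's `abs_twoRun_step_sub_le_unif` without
`k₀ ≤ j`): the couplings of the pinned lattice trajectories with `j+m+1` and `j+m` steps (spacings `ε/L` and `ε`
below the same unit scale, the same infrared datum), compared AT THE SAME SCALE `j`, differ by one continuum scale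
step up to `O(log m/√m)`: `|1/g_{j+m+1}(j)² − 1/g_{j+m}(j)² − β⁰_∞| ≤ A·log m/√m` for every `j` and `m ≥ 2`. [folklore] -/
theorem abs_twoRun_step_le_unif (S : B12Beta.OneLoopSplit β) (hθ1 : θ < 1) (hb : 0 < b)
    (hlo : EventualLowerH b γ k₀ β) (hC₁ : 0 ≤ C₁)
    (hAF1 : ∀ k (p : Fin (k + 1) → ℝ), p ∈ Box γ k → |S.β1 k p| ≤ C₁ * p (Fin.last k))
    (hθ₀0 : 0 ≤ θ₀) (hθ₀1 : θ₀ < 1) (hrate : ∀ k, |S.β0 k - binf| ≤ c₀ * θ₀ ^ k) :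
    ∃ A : ℝ, 0 ≤ A ∧ ∀ (G : ℕ → ℕ → ℝ) (gir : ℝ), InjectedRate C 0 θ (fun K j => disc (G K) (G (K + 1)) j) →
      (∀ K, RGEqH K β (G K)) → (∀ K i, i ≤ K → 0 < G K i ∧ G K i ≤ γ) → (∀ K, G K K = gir) →
      ∀ (j : ℕ) ⦃m : ℕ⦄, 2 ≤ m →
        |invSq G (m + 1) j - invSq G m j - binf| ≤ A * (Real.log m / Real.sqrt m) := by
  obtain ⟨A, hA0, hA⟩ := abs_matchErr_le_unif (C := C) S hθ1 hb hlo hC₁ hAF1 hθ₀0 hθ₀1 hrate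
  have hlog2 : 0 < Real.log 2 := Real.log_pos one_lt_two
  have hsb : 0 < Real.sqrt b := Real.sqrt_pos.2 hb
  refine ⟨3 * A + C₁ / (Real.sqrt b * Real.log 2), by positivity, ?_⟩
  intro G gir hinj hrun hbox hpin j m hm2
  have hmr : (2 : ℝ) ≤ m := by exact_mod_cast hm2
  have hm0 : (0 : ℝ) < m := by linarith
  have hlogm0 : 0 ≤ Real.log (m : ℝ) := hlog2.le.trans (Real.log_le_log two_pos hmr)
  have hs0 : 0 < Real.sqrt (m : ℝ) := Real.sqrt_pos.2 hm0
  have hu0 : 0 ≤ Real.log m / Real.sqrt m := div_nonneg hlogm0 hs0.le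
  have h1 := hA G gir hinj hrun hbox hpin j (m := m + 1) (by omega)
  have h0 := hA G gir hinj hrun hbox hpin j hm2
  have hb1 := abs_bstar_sub_binf_le_inv_sqrt S hθ1 hinj hrun hbox hpin hb hlo hC₁ hAF1 hθ₀0 hθ₀1 hrate
    (g := G) (m := m) (by omega)
  have hsucc : Real.log ((m + 1 : ℕ) : ℝ) / Real.sqrt ((m + 1 : ℕ) : ℝ) ≤ 2 * (Real.log m / Real.sqrt m) := by
    push_cast; exact log_succ_div_sqrt_le hm2
  have h1' : |invSq G (m + 1) j - astar G (m + 1) - uvDefect S binf j| ≤ 2 * A * (Real.log m / Real.sqrt m) := by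
    refine h1.trans ?_
    have h := mul_le_mul_of_nonneg_left hsucc hA0
    linarith only [h]
  have hb1' : |bstar G m - binf| ≤ C₁ / (Real.sqrt b * Real.log 2) * (Real.log m / Real.sqrt m) := by
    refine hb1.trans ?_
    have h := mul_le_mul_of_nonneg_left (inv_sqrt_le_log_div_sqrt hm2) (div_nonneg hC₁ hsb.le : 0 ≤ C₁ / Real.sqrt b)
    calc C₁ / (Real.sqrt b * Real.sqrt m) = C₁ / Real.sqrt b * (1 / Real.sqrt m) := by ring
      _ ≤ C₁ / Real.sqrt b * ((Real.log m / Real.sqrt m) / Real.log 2) := h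
      _ = C₁ / (Real.sqrt b * Real.log 2) * (Real.log m / Real.sqrt m) := by ring
  have e : invSq G (m + 1) j - invSq G m j - binf =
      (invSq G (m + 1) j - astar G (m + 1) - uvDefect S binf j) -
        (invSq G m j - astar G m - uvDefect S binf j) + (bstar G m - binf) := by
    unfold bstar; ring
  rw [e]
  calc |(invSq G (m + 1) j - astar G (m + 1) - uvDefect S binf j) -
        (invSq G m j - astar G m - uvDefect S binf j) + (bstar G m - binf)|
      ≤ |invSq G (m + 1) j - astar G (m + 1) - uvDefect S binf j| +
          |invSq G m j - astar G m - uvDefect S binf j| + |bstar G m - binf| :=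
        (abs_add_le _ _).trans (add_le_add (abs_sub _ _) le_rfl)
    _ ≤ 2 * A * (Real.log m / Real.sqrt m) + A * (Real.log m / Real.sqrt m) +
          C₁ / (Real.sqrt b * Real.log 2) * (Real.log m / Real.sqrt m) := add_le_add (add_le_add h1' h0) hb1'
    _ = (3 * A + C₁ / (Real.sqrt b * Real.log 2)) * (Real.log m / Real.sqrt m) := by ring

/-! ## §3 The bare two-loop law WITH ITS CONSTANT AND A RATE: `1/g_K(0)² = Kβ⁰_∞ + (β¹¹_∞/β⁰_∞)log K + Λ₀ + O(log K/√K)` -/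

/-- The constant of the continuum `M^{−1/2}`-law is nonnegative. [folklore] -/
theorem contLambdaRate_nonneg (hb : 0 < b) (hbinf : 0 < binf) (hC₁ : 0 ≤ C₁) (hC₃ : 0 ≤ C₃) :
    0 ≤ contLambdaRate gIR b binf C₁ b1inf C₃ := by
  unfold contLambdaRate
  positivity

/-- **THE BARE COUPLING'S TWO-LOOP LAW WITH ITS CONSTANT, QUANTIFIED.**  For a family of box runs of (0.20) pinned at
`g_K(K) = g_IR`, under node U2's OUTPUT SHAPE `InjectedRate C 0 θ (disc …)` (`θ < 1`), `EventualLowerH b γ k₀ β`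
(`b > 0`), the printed split shape `B12Beta.OneLoopSplit` with (AF-0r) IN RATE FORM `|β⁰_k − β⁰_∞| ≤ c₀θ₀^k`, (AF-1)
`|β¹_{k+1}(p)| ≤ C₁p_k` and the two-loop split (TL) `|β¹_{k+1}(p) − β¹¹_∞p_k²| ≤ C₃p_k³ + c₁θ₁^k` — ALL NAMED BINDERS,
NOT PRINTED for Bałaban's β —: **`|1/g_K(0)² − (K·β⁰_∞ + (β¹¹_∞/β⁰_∞)·log K + Λ₀)| ≤ A·log K/√K` for every `K ≥ 2`**,
with `Λ₀ = T4LambdaMatching.bareLambda = Λ⋆ + δ₀`.  Gen 9's `T4LambdaMatching.tendsto_bareLambdaSeq` was the pure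
limit; the rate is the sum of this file's matching rate at the bare end (`abs_matchErr_le_unif`, `j = 0`, `m = K`:
`O(log K/√K)`) and gen 9's continuum Λ-law `T4ContinuumLambda.abs_lambdaSeq_sub_contLambda_le` (`O(K^{−1/2})`).  Read
with `K = log_L(a₀/ε)` scales between the spacing `ε` and the unit scale: `1/g₀(ε)² = β⁰_∞·log_L(a₀/ε) +
(β¹¹_∞/β⁰_∞)·log log_L(a₀/ε) + Λ₀ + O(log log(1/ε)/√log(1/ε))` — the two-loop asymptotic-freedom formula for the
bare charge at fixed renormalised datum, with an explicit (not optimal) error law.  COUPLING CONSTANTS of the fixed-T⁴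
flow only. [cite: Balaban1987RG1, Theorem 2 p.259] for the SETTING only ("more precise asymptotic behavior will be
proved" in a separate paper — deferred there and NOT PRINTED); [cite: Creutz2022, (13.19) p.65] for the SHAPE of the
law; the statement is this file's, over the binders. -/
theorem abs_bare_sub_lambdaLaw_le (S : B12Beta.OneLoopSplit β) (hθ1 : θ < 1)
    (hinj : InjectedRate C 0 θ (fun K j => disc (g K) (g (K + 1)) j)) (hrun : ∀ K, RGEqH K β (g K))
    (hbox : ∀ K i, i ≤ K → 0 < g K i ∧ g K i ≤ γ) (hpin : ∀ K, g K K = gIR)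
    (hb : 0 < b) (hlo : EventualLowerH b γ k₀ β) (hC₁ : 0 ≤ C₁)
    (hAF1 : ∀ k (p : Fin (k + 1) → ℝ), p ∈ Box γ k → |S.β1 k p| ≤ C₁ * p (Fin.last k))
    (hθ₀0 : 0 ≤ θ₀) (hθ₀1 : θ₀ < 1) (hrate : ∀ k, |S.β0 k - binf| ≤ c₀ * θ₀ ^ k) (hC₃ : 0 ≤ C₃)
    (hθ₁0 : 0 ≤ θ₁) (hθ₁1 : θ₁ < 1)
    (hTL : ∀ k (p : Fin (k + 1) → ℝ), p ∈ Box γ k →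
      |S.β1 k p - b1inf * p (Fin.last k) ^ 2| ≤ C₃ * p (Fin.last k) ^ 3 + c₁ * θ₁ ^ k) :
    ∃ A : ℝ, 0 ≤ A ∧ ∀ ⦃K : ℕ⦄, 2 ≤ K →
      |1 / (g K 0) ^ 2 - ((K : ℝ) * binf + b1inf / binf * Real.log K + bareLambda S g binf b1inf)| ≤
        A * (Real.log K / Real.sqrt K) := by
  obtain ⟨A, hA0, hA⟩ := abs_matchErr_le_unif (C := C) S hθ1 hb hlo hC₁ hAF1 hθ₀0 hθ₀1 hrate
  have hγ : 0 < γ := (hbox 0 0 le_rfl).1.trans_le (hbox 0 0 le_rfl).2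
  have hconv : Tendsto S.β0 atTop (𝓝 binf) := tendsto_of_abs_sub_le_geom hθ₀0 hθ₀1 hrate
  have hbinf : 0 < binf := hb.trans_le (af_le_binf S hγ hlo hAF1 hconv)
  have hlog2 : 0 < Real.log 2 := Real.log_pos one_lt_two
  set cR : ℝ := contLambdaRate gIR b binf C₁ b1inf C₃ with hcR
  have hcR0 : 0 ≤ cR := contLambdaRate_nonneg hb hbinf hC₁ hC₃
  refine ⟨A + cR / Real.log 2, by positivity, ?_⟩
  intro K hK2
  have hKr : (2 : ℝ) ≤ K := by exact_mod_cast hK2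
  have hK0 : (0 : ℝ) < K := by linarith
  have hlogK0 : 0 ≤ Real.log (K : ℝ) := hlog2.le.trans (Real.log_le_log two_pos hKr)
  have hsK : 0 < Real.sqrt (K : ℝ) := Real.sqrt_pos.2 hK0
  have hu0 : 0 ≤ Real.log K / Real.sqrt K := div_nonneg hlogK0 hsK.le
  -- the bare matching with rate, `j = 0`, `m = K`
  have h1 := hA g gIR hinj hrun hbox hpin 0 hK2
  rw [uvDefect_zero] at h1
  have e1 : invSq g K 0 = 1 / (g K 0) ^ 2 := by simp [invSq]
  rw [e1] at h1
  -- the continuum Λ-law with rate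
  have h2 := abs_lambdaSeq_sub_contLambda_le S hθ1 hinj hrun hbox hpin hb hlo hC₁ hAF1 hconv hC₃ hθ₁0 hθ₁1 hTL
    (b1inf := b1inf) (c₁ := c₁) (M := K) (by omega)
  have h2' : |astar g K - (K : ℝ) * binf - b1inf / binf * Real.log K - contLambda g binf b1inf| ≤
      cR / Real.log 2 * (Real.log K / Real.sqrt K) := by
    refine h2.trans ?_
    have h := mul_le_mul_of_nonneg_left (inv_sqrt_le_log_div_sqrt hK2) hcR0
    calc cR / Real.sqrt K = cR * (1 / Real.sqrt K) := by ring
      _ ≤ cR * ((Real.log K / Real.sqrt K) / Real.log 2) := h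
      _ = cR / Real.log 2 * (Real.log K / Real.sqrt K) := by ring
  have e : 1 / (g K 0) ^ 2 - ((K : ℝ) * binf + b1inf / binf * Real.log K + bareLambda S g binf b1inf) =
      (1 / (g K 0) ^ 2 - astar g K - oneLoopDefect S binf) +
        (astar g K - (K : ℝ) * binf - b1inf / binf * Real.log K - contLambda g binf b1inf) := by
    unfold bareLambda; ring
  rw [e]
  calc |(1 / (g K 0) ^ 2 - astar g K - oneLoopDefect S binf) +
        (astar g K - (K : ℝ) * binf - b1inf / binf * Real.log K - contLambda g binf b1inf)|
      ≤ |1 / (g K 0) ^ 2 - astar g K - oneLoopDefect S binf| +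
          |astar g K - (K : ℝ) * binf - b1inf / binf * Real.log K - contLambda g binf b1inf| := abs_add_le _ _
    _ ≤ A * (Real.log K / Real.sqrt K) + cR / Real.log 2 * (Real.log K / Real.sqrt K) := add_le_add h1 h2'
    _ = (A + cR / Real.log 2) * (Real.log K / Real.sqrt K) := by ring

/-- **`1/g_K(0)² − K·β⁰_∞ − (β¹¹_∞/β⁰_∞)·log K − Λ₀ = O(log K/√K)`** — gen 9's `tendsto_bareLambdaSeq` (the `O(1)` of the
bare two-loop law converges to `Λ₀`) WITH A RATE. [cite: Creutz2022, (13.19) p.65] for the SHAPE only. -/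
theorem isBigO_bare_sub_lambdaLaw (S : B12Beta.OneLoopSplit β) (hθ1 : θ < 1)
    (hinj : InjectedRate C 0 θ (fun K j => disc (g K) (g (K + 1)) j)) (hrun : ∀ K, RGEqH K β (g K))
    (hbox : ∀ K i, i ≤ K → 0 < g K i ∧ g K i ≤ γ) (hpin : ∀ K, g K K = gIR)
    (hb : 0 < b) (hlo : EventualLowerH b γ k₀ β) (hC₁ : 0 ≤ C₁)
    (hAF1 : ∀ k (p : Fin (k + 1) → ℝ), p ∈ Box γ k → |S.β1 k p| ≤ C₁ * p (Fin.last k))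
    (hθ₀0 : 0 ≤ θ₀) (hθ₀1 : θ₀ < 1) (hrate : ∀ k, |S.β0 k - binf| ≤ c₀ * θ₀ ^ k) (hC₃ : 0 ≤ C₃)
    (hθ₁0 : 0 ≤ θ₁) (hθ₁1 : θ₁ < 1)
    (hTL : ∀ k (p : Fin (k + 1) → ℝ), p ∈ Box γ k →
      |S.β1 k p - b1inf * p (Fin.last k) ^ 2| ≤ C₃ * p (Fin.last k) ^ 3 + c₁ * θ₁ ^ k) :
    (fun K : ℕ => 1 / (g K 0) ^ 2 - (K : ℝ) * binf - b1inf / binf * Real.log K - bareLambda S g binf b1inf)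
      =O[atTop] (fun K : ℕ => Real.log (K : ℝ) / Real.sqrt (K : ℝ)) := by
  obtain ⟨A, -, hA⟩ := abs_bare_sub_lambdaLaw_le S hθ1 hinj hrun hbox hpin hb hlo hC₁ hAF1 hθ₀0 hθ₀1 hrate hC₃
    hθ₁0 hθ₁1 hTL (b1inf := b1inf) (c₁ := c₁)
  refine IsBigO.of_bound A ?_
  filter_upwards [eventually_ge_atTop 2] with K hK
  have hKr : (2 : ℝ) ≤ K := by exact_mod_cast hK
  have hu0 : 0 ≤ Real.log K / Real.sqrt K :=
    div_nonneg ((Real.log_pos one_lt_two).le.trans (Real.log_le_log two_pos hKr)) (Real.sqrt_nonneg _)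
  rw [Real.norm_eq_abs, Real.norm_eq_abs, abs_of_nonneg hu0]
  have e : 1 / (g K 0) ^ 2 - (K : ℝ) * binf - b1inf / binf * Real.log K - bareLambda S g binf b1inf =
      1 / (g K 0) ^ 2 - ((K : ℝ) * binf + b1inf / binf * Real.log K + bareLambda S g binf b1inf) := by ring
  rw [e]
  exact hA hK

end Matching

/-! ## §4 The chart form for β-functions with unique box continuation, and the sanity example -/

section Markov

variable {β : HBeta} {γ q b C₁ binf b1inf C₃ c₁ θ₁ c₀ θ₀ C θ : ℝ} {k₀ : ℕ}

/-- THE CHART FORM: for a β with unique box continuation (`BackwardWP β γ q`, gen 8) whose PINNED FAMILY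
(`T4ContinuumTwoLoopLaw.pinnedRun`) has node U2's output shape `InjectedRate C 0 θ` (a BINDER — for history-dependent β
this is the estimate NE4 itself, NOT PRINTED), gen 8's bare chart `ḡ₀(K, g)` obeys the two-loop law WITH CONSTANT AND
RATE: `|1/ḡ₀(K,g)² − (K·β⁰_∞ + (β¹¹_∞/β⁰_∞)·log K + Λ₀)| ≤ A·log K/√K` (`K ≥ 2`). [cite: Balaban1987RG1, Theorem 2 p.259]
for the SETTING only. -/
theorem abs_invSq_bareOf_sub_lambdaLaw_le (H : BackwardWP β γ q) (S : B12Beta.OneLoopSplit β) {g : ℝ}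
    (hg : 0 < g) (hgγ : g ≤ γ) (hθ1 : θ < 1)
    (hinj : InjectedRate C 0 θ (fun K j => disc (pinnedRun β γ K g) (pinnedRun β γ (K + 1) g) j))
    (hb : 0 < b) (hlo : EventualLowerH b γ k₀ β) (hC₁ : 0 ≤ C₁)
    (hAF1 : ∀ k (p : Fin (k + 1) → ℝ), p ∈ Box γ k → |S.β1 k p| ≤ C₁ * p (Fin.last k))
    (hθ₀0 : 0 ≤ θ₀) (hθ₀1 : θ₀ < 1) (hrate : ∀ k, |S.β0 k - binf| ≤ c₀ * θ₀ ^ k) (hC₃ : 0 ≤ C₃)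
    (hθ₁0 : 0 ≤ θ₁) (hθ₁1 : θ₁ < 1)
    (hTL : ∀ k (p : Fin (k + 1) → ℝ), p ∈ Box γ k →
      |S.β1 k p - b1inf * p (Fin.last k) ^ 2| ≤ C₃ * p (Fin.last k) ^ 3 + c₁ * θ₁ ^ k) :
    ∃ A : ℝ, 0 ≤ A ∧ ∀ ⦃K : ℕ⦄, 2 ≤ K →
      |1 / (bareOf β γ K g) ^ 2 -
          ((K : ℝ) * binf + b1inf / binf * Real.log K + bareLambda S (fun K => pinnedRun β γ K g) binf b1inf)| ≤
        A * (Real.log K / Real.sqrt K) := by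
  have hrun : ∀ K, RGEqH K β (pinnedRun β γ K g) := fun K => (pinnedRun_spec H K hg hgγ).2.1
  have hbox : ∀ K i, i ≤ K → 0 < pinnedRun β γ K g i ∧ pinnedRun β γ K g i ≤ γ :=
    fun K => (pinnedRun_spec H K hg hgγ).2.2
  have hpin : ∀ K, pinnedRun β γ K g K = g := fun K => (pinnedRun_spec H K hg hgγ).1
  obtain ⟨A, hA0, hA⟩ := abs_bare_sub_lambdaLaw_le S hθ1 hinj hrun hbox hpin hb hlo hC₁ hAF1 hθ₀0 hθ₀1 hrate hC₃
    hθ₁0 hθ₁1 hTL (b1inf := b1inf) (c₁ := c₁)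
  refine ⟨A, hA0, fun K hK => ?_⟩
  rw [← pinnedRun_zero H K hg hgγ]
  exact hA hK

/-- SANITY (non-vacuity, and the rate law in action on an exactly solvable family): for the two-loop MARKOV family
`β_{k+1}(g_0,…,g_k) = b + c·g_k²` (`b > 0`, `c ≥ 0`, `2cγ(γ³ + 2γ/b) < 1/2`) EVERY binder of `abs_bare_sub_lambdaLaw_le`
holds for the pinned family of every datum `g_IR ∈ ]0,γ]` (β⁰_j ≡ b, so (AF-0r) with `c₀ = 0`; `β¹¹_∞ = c`; (TL) with
`C₃ = c₁ = 0`; `InjectedRate 0 0 0` by scale-shift invariance, `T4ContinuumTwoLoopLaw.injectedRate_pinnedRun`), the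
one-loop defect VANISHES (`Λ₀ = Λ⋆`), and so: `|1/g_K(0)² − (K·b + (c/b)·log K + Λ⋆)| ≤ A·log K/√K` for all `K ≥ 2`.
[folklore] -/
example {γ b c gIR : ℝ} (hγ : 0 < γ) (hb : 0 < b) (hc : 0 ≤ c)
    (hsmall : 2 * c * γ * (γ ^ 3 + 2 * γ / b) < 1 / 2) (hgIR : 0 < gIR) (hgIRγ : gIR ≤ γ) :
    ∃ A : ℝ, 0 ≤ A ∧ ∀ ⦃K : ℕ⦄, 2 ≤ K →
      |1 / (pinnedRun (fun k (p : Fin (k + 1) → ℝ) => b + c * p (Fin.last k) ^ 2) γ K gIR 0) ^ 2 -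
          ((K : ℝ) * b + c / b * Real.log K +
            contLambda (fun K => pinnedRun (fun k (p : Fin (k + 1) → ℝ) => b + c * p (Fin.last k) ^ 2) γ K gIR) b c)|
        ≤ A * (Real.log K / Real.sqrt K) := by
  obtain ⟨q, H⟩ := backwardWP_twoLoopMarkov hγ hb hc hsmall
  set β : HBeta := fun k p => b + c * p (Fin.last k) ^ 2 with hβ
  have hmk : ∀ k (p : Fin (k + 1) → ℝ), β k p = (fun x => b + c * x ^ 2) (p (Fin.last k)) := fun _ _ => rfl
  let S : B12Beta.OneLoopSplit β :=
    { β0 := fun _ => b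
      β1 := fun k p => c * p (Fin.last k) ^ 2
      split := fun k p => rfl
      vanish := fun k p hp => by simp [hp] }
  have hAF1 : ∀ k (p : Fin (k + 1) → ℝ), p ∈ Box γ k → |S.β1 k p| ≤ c * γ * p (Fin.last k) := by
    intro k p hp
    have h := (mem_box.1 hp) (Fin.last k)
    show |c * p (Fin.last k) ^ 2| ≤ c * γ * p (Fin.last k)
    rw [abs_of_nonneg (by positivity)]
    nlinarith [mul_nonneg hc h.1.le, h.2]
  have hrate : ∀ k, |S.β0 k - b| ≤ 0 * (0 : ℝ) ^ k := fun k => by simp [S]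
  have hlo : EventualLowerH b γ 0 β := fun k v _ _ => le_add_of_nonneg_right (mul_nonneg hc (sq_nonneg _))
  have hTL : ∀ k (p : Fin (k + 1) → ℝ), p ∈ Box γ k →
      |S.β1 k p - c * p (Fin.last k) ^ 2| ≤ 0 * p (Fin.last k) ^ 3 + 0 * (0 : ℝ) ^ k := fun k p _ => by simp [S]
  have hrun : ∀ K, RGEqH K β (pinnedRun β γ K gIR) := fun K => (pinnedRun_spec H K hgIR hgIRγ).2.1
  have hbox : ∀ K i, i ≤ K → 0 < pinnedRun β γ K gIR i ∧ pinnedRun β γ K gIR i ≤ γ :=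
    fun K => (pinnedRun_spec H K hgIR hgIRγ).2.2
  have hpin : ∀ K, pinnedRun β γ K gIR K = gIR := fun K => (pinnedRun_spec H K hgIR hgIRγ).1
  have hinj : InjectedRate 0 0 0 (fun K j => disc (pinnedRun β γ K gIR) (pinnedRun β γ (K + 1) gIR) j) :=
    injectedRate_pinnedRun H (f := fun x => b + c * x ^ 2) hmk hgIR hgIRγ 0
  obtain ⟨A, hA0, hA⟩ := abs_bare_sub_lambdaLaw_le S zero_lt_one hinj hrun hbox hpin hb hlo (by positivity) hAF1
    le_rfl zero_lt_one hrate le_rfl le_rfl zero_lt_one hTL (b1inf := c) (c₁ := 0)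
  -- the one-loop defect vanishes identically: Λ₀ = Λ⋆
  have hδ : oneLoopDefect S b = 0 := by simp [oneLoopDefect, S]
  have hΛ : bareLambda S (fun K => pinnedRun β γ K gIR) b c = contLambda (fun K => pinnedRun β γ K gIR) b c := by
    rw [bareLambda, hδ, add_zero]
  refine ⟨A, hA0, fun K hK => ?_⟩
  have h := hA hK
  rw [hΛ] at h
  exact h

end Markov

end Literature.MathematicalPhysics.QuantumFieldTheory.Balaban1983to89.T4BareLambdaRate
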